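import Summits.ABC.ABC.Theses.PadicPrincipalCoreRadThree
import Summits.ABC.ABC.Theorems.PadicPrincipalCoreST86TheoremA
import Summits.ABC.ABC.Theorems.PadicTheoremAOne
import HarnessLib

/-!
# Route PadicPrincipalCoreRadThree, crux item `TheoremAOne`: CLOSED

`Summits/ABC/ABC/Theorems/PadicPrincipalCoreRadThreeTheoremAOne.lean` — cell `abc-stewartyu`, seat p3.
Theorem A with cap `c₂ ≤ 1` is `Summit.ABC.StewartYu.theoremAShapeLe_one_holds` (`c₁ = 2⁷⁰`,
`c₂ = 1`, `r = 0`; `Summits/ABC/ABC/Theorems/PadicPrincipalCoreST86TheoremA.lean`); the same term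
also proves p1's named conjecture decl `PadicTheoremAOne.TheoremAOne` (the route's conditional premise).
-/

set_option linter.dupNamespace false

namespace Summit.ABC.ABC.Theorems

/-- **Item `TheoremAOne` of route PadicPrincipalCoreRadThree.** [folklore] -/
theorem padicPrincipalCoreRadThree_theoremAOne_proof :
    Summit.ABC.ABC.Theses.PadicPrincipalCoreRadThree.TheoremAOne :=
  Summit.ABC.StewartYu.theoremAShapeLe_one_holds

/-- **The named conjecture `PadicTheoremAOne.TheoremAOne` (p1's conditional-bridge premise of route
PadicPrincipalCoreRadThree) HOLDS** — same text, same proof; this discharges the route's conditional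
bridge. [folklore] -/
theorem padicTheoremAOne_holds : Summit.ABC.ABC.Theorems.PadicTheoremAOne.TheoremAOne :=
  Summit.ABC.StewartYu.theoremAShapeLe_one_holds

end Summit.ABC.ABC.Theorems
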